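import Summits.BirchSwinnertonDyer.Rank1Residual.Additive.CongruentLambdaShiftOfEPW
import Summits.BirchSwinnertonDyer.Rank1Residual.Additive.GordRamifiedOrdinaryLinePair
import HarnessLib

/-!
# Route G's typed input `CongruentLambdaShift` and the `μ = 0` transfer on a congruent pair of
# X4♯(G-ord) / X3♯(G-ord) rows, from the cited EPW transfer and `TorsionIso` ALONE — the line data of
# cc-typer-1's `congruentLambdaShift_of_epw` / `mu_eq_zero_of_epw` DISCHARGED (TB-ROL FILE F; team
# n1011, seat p10 gen 3, row TB-ROL (G-ord) half per lead GEN 6 R5-37)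

HONEST FRAMING (cell `b2b-bsdres`, run/shared/lean/b2b/bsd-rank1-residual/, verbatim in every
file): the goal of the cell is to DELETE the COMBINATION-SHAPED residual classes of the
Birch–Swinnerton-Dyer formula for ALL analytic-rank `≤ 1` elliptic curves over `ℚ` — "full BSD
formula for every rank `≤ 1` curve in class `C`" assembled STRICTLY from published theorems — so
that the rank-`≤ 1` remainder becomes exactly the CONSTRUCTION-SHAPED classes, which are TYPED
(missing-input `Prop`s), NOT attempted. This is not "finishing BSD". Team n1011 (N10/N11: X4 ∧
`p = 3`): research route on the CONSTRUCTION-SHAPED class X4; prove what is provable now; no claim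
beyond stated classes; census output = EVIDENCE / conjecture items, never a Literature fact;
X4♯(G-ord) / X3♯(G-ord) stay CONSTRUCTION-SHAPED; RESIDUAL-MAP marks UNCHANGED; nothing is booked by
this file. Theorems only: NO definition, NO new named fact, NO conjecture node. The named fact `hEPW`
(`EmertonPollackWeston2006.muLambdaAlg_transfer_of_torsionIso_potOrd`, EPW 2006 Thms. 3.3.2 / 3.3.3 (2)
/ Lemma 5.1.5) enters as a HYPOTHESIS exactly as in cc-typer-1's file; no hypothesis of that file is
silently dropped — its binders `hL₁`, `hL₂`, `hiso` (ramified ordinary lines, line-respecting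
isomorphism) and the place `v` are SUPPLIED by the theorems of `GordRamifiedOrdinaryLine[Pair].lean`.

## What

For two `p*`-twist models `W₁ = C₁ • V₁^{(p*)}`, `W₂ = C₂ • V₂^{(p*)}` of GOOD ORDINARY curves at the
odd prime `p` (in particular two X4♯(G-ord) ∩ `I₀*` rows, or two X3♯(G-ord) ∩ `I₀*` rows), `E₁[p]`
irreducible, `TorsionIso W₁ W₂ p` and a finite `Σ₀ ∌ p` outside which both are good:
* `congruentLambdaShift_of_epw_of_goodOrd_pStar_twists`, `ClassX4Gord.congruentLambdaShift_of_epw_of_torsionIso`,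
  `ClassX3Gord.…` — `CongruentLambdaShift W₁ W₂ p (Σ_{w∈Σ₀} (δ(E₂,w) − δ(E₁,w)))` (Route G's typed
  input `X1.CongruenceTransfer.CongruentLambdaShift`, EPW Thm. 3.3.3 (2) + Lemma 5.1.5);
* `mu_eq_zero_of_epw_of_goodOrd_pStar_twists`, `ClassX4Gord.mu_eq_zero_of_epw_of_torsionIso` —
  `μ(X(E₁)) = 0 ⟹ μ(X(E₂)) = 0` for torsion cyclotomic dual data (EPW Thm. 3.3.2).
Remaining per-pair inputs: `TorsionIso` (GV Thm. (1.4) currency; Kraus–Oesterlé / Sturm certificate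
tier), `E₁[p]` irreducible (e.g. from `ρ̄_{E₁,p}` onto), `Σ₀`. Nothing booked.

References: Emerton–Pollack–Weston, Invent. Math. 163 (2006) Thms. 3.3.2, 3.3.3 (2), Lemma 5.1.5, p. 3
[EmertonPollackWeston2006]; Greenberg–Vatsal, Invent. Math. 142 (2000) Thm. (1.4), §2 p. 26
[GreenbergVatsal2000].
-/

set_option autoImplicit false

noncomputable section

open scoped Classical NumberField

open NumberField IsDedekindDomain Field WeierstrassCurve
  Literature.NumberTheory.GaloisRepresentations
  Literature.NumberTheory.EllipticCurves
  Literature.NumberTheory.EllipticCurves.Rank1Residual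
  Literature.NumberTheory.EllipticCurves.GreenbergSelmer
  Literature.NumberTheory.EllipticCurves.GreenbergVatsal2000
  Literature.NumberTheory.EllipticCurves.EmertonPollackWeston2006
  Summit.BirchSwinnertonDyer.Rank1Residual.X1.CongruenceTransfer

namespace Summit.BirchSwinnertonDyer.Rank1Residual.Additive

variable {p : ℕ} [hp : Fact p.Prime]

/-- The place `v_p` of `ℚ` above the prime `p` exists (`(p)` is contained in a maximal ideal of
`𝓞 ℚ`, which is non-zero since `p ≠ 0`). [folklore] -/
private theorem exists_natCast_mem_asIdeal :
    ∃ v : HeightOneSpectrum (𝓞 ℚ), ((p : ℕ) : 𝓞 ℚ) ∈ v.asIdeal := by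
  have hnu : ¬ IsUnit ((p : ℕ) : 𝓞 ℚ) := by
    intro h
    have h' := h.map Rat.ringOfIntegersEquiv
    rw [map_natCast, Int.isUnit_iff_natAbs_eq, Int.natAbs_natCast] at h'
    exact hp.out.one_lt.ne' h'
  obtain ⟨M, hM, hle⟩ := Ideal.exists_le_maximal (Ideal.span {((p : ℕ) : 𝓞 ℚ)})
    (by rwa [Ne, Ideal.span_singleton_eq_top])
  have hpM : ((p : ℕ) : 𝓞 ℚ) ∈ M := hle (Ideal.mem_span_singleton_self _)
  refine ⟨⟨M, hM.isPrime, fun hbot ↦ ?_⟩, hpM⟩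
  rw [hbot, Ideal.mem_bot] at hpM
  exact hp.out.ne_zero (by exact_mod_cast hpM)

variable (p)

/-- **`CongruentLambdaShift` from EPW + `TorsionIso`, for two `p*`-twist models of good-ordinary
curves.** `p` odd; `W₁ = C₁ • V₁^{(p*)}`, `W₂ = C₂ • V₂^{(p*)}` with `V₁`, `V₂` globally minimal good
ordinary at `p`; `E₁[p]` irreducible; `TorsionIso W₁ W₂ p`; `Σ₀ ∌ p` outside which both curves are
good. Then `CongruentLambdaShift W₁ W₂ p (Σ_{w∈Σ₀} (δ(E₂,w) − δ(E₁,w)))`. The lines and the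
line-respecting isomorphism that EPW demands are `exists_epwLineData_of_goodOrd_pStar_twist` at `v_p`.
[cite: EmertonPollackWeston2006, Thm. 3.3.3 (2) (arXiv:math/0404484 p. 19), Lemma 5.1.5 (p. 30), p. 3]
[cite: GreenbergVatsal2000, Thm. (1.4) and §2 p. 26] -/
theorem congruentLambdaShift_of_epw_of_goodOrd_pStar_twists
    (hEPW : muLambdaAlg_transfer_of_torsionIso_potOrd) (hp2 : p ≠ 2)
    {W₁ W₂ : WeierstrassCurve ℚ} [W₁.IsElliptic] [W₁.IsGloballyMinimal] [W₂.IsElliptic]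
    [W₂.IsGloballyMinimal]
    (V₁ V₂ : WeierstrassCurve ℚ) [V₁.IsElliptic] [V₁.IsGloballyMinimal] [V₂.IsElliptic]
    [V₂.IsGloballyMinimal]
    (hCW₁ : ∃ C₁ : VariableChange ℚ, C₁ • V₁.quadraticTwist ((-1 : ℚ) ^ (p / 2) * p) = W₁)
    (hCW₂ : ∃ C₂ : VariableChange ℚ, C₂ • V₂.quadraticTwist ((-1 : ℚ) ^ (p / 2) * p) = W₂)
    (hV₁ : GoodOrd V₁ p) (hV₂ : GoodOrd V₂ p) (hirr : W₁.HasIrreducibleModPGaloisRep p)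
    (hT : TorsionIso W₁ W₂ p)
    (S₀ : Finset (HeightOneSpectrum (𝓞 ℚ))) (hS₀ : ∀ w ∈ S₀, ((p : ℕ) : 𝓞 ℚ) ∉ w.asIdeal)
    (hS₁ : ∀ w : HeightOneSpectrum (𝓞 ℚ), w ∉ S₀ → ((p : ℕ) : 𝓞 ℚ) ∉ w.asIdeal →
      W₁.HasGoodReductionAt w)
    (hS₂ : ∀ w : HeightOneSpectrum (𝓞 ℚ), w ∉ S₀ → ((p : ℕ) : 𝓞 ℚ) ∉ w.asIdeal →
      W₂.HasGoodReductionAt w) :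
    CongruentLambdaShift W₁ W₂ p (∑ w ∈ S₀, ((delta W₂ p w : ℤ) - (delta W₁ p w : ℤ))) := by
  obtain ⟨v, hv⟩ := exists_natCast_mem_asIdeal (p := p)
  obtain ⟨L₁, L₂, hL₁, hL₂, hiso⟩ :=
    exists_epwLineData_of_goodOrd_pStar_twist p hp2 V₁ V₂ hCW₁ hCW₂ hV₁ hV₂ hT hv
  exact congruentLambdaShift_of_epw W₁ W₂ p S₀ hEPW hp2 hv hL₁ hL₂ hirr hiso hS₀ hS₁ hS₂

/-- **`μ = 0` transfer from EPW + `TorsionIso`, for two `p*`-twist models of good-ordinary curves**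
(EPW Thm. 3.3.2): under the hypotheses of the previous theorem, for the cyclotomic data and torsion
dual data `D₁`, `D₂`: `μ(X(E₁)) = 0 ⟹ μ(X(E₂)) = 0`.
[cite: EmertonPollackWeston2006, Thm. 3.3.2 (arXiv:math/0404484 p. 19), p. 3]
[cite: GreenbergVatsal2000, Thm. (1.4) and §2 p. 26] -/
theorem mu_eq_zero_of_epw_of_goodOrd_pStar_twists
    (hEPW : muLambdaAlg_transfer_of_torsionIso_potOrd) (hp2 : p ≠ 2)
    {W₁ W₂ : WeierstrassCurve ℚ} [W₁.IsElliptic] [W₁.IsGloballyMinimal] [W₂.IsElliptic]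
    [W₂.IsGloballyMinimal]
    (V₁ V₂ : WeierstrassCurve ℚ) [V₁.IsElliptic] [V₁.IsGloballyMinimal] [V₂.IsElliptic]
    [V₂.IsGloballyMinimal]
    (hCW₁ : ∃ C₁ : VariableChange ℚ, C₁ • V₁.quadraticTwist ((-1 : ℚ) ^ (p / 2) * p) = W₁)
    (hCW₂ : ∃ C₂ : VariableChange ℚ, C₂ • V₂.quadraticTwist ((-1 : ℚ) ^ (p / 2) * p) = W₂)
    (hV₁ : GoodOrd V₁ p) (hV₂ : GoodOrd V₂ p) (hirr : W₁.HasIrreducibleModPGaloisRep p)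
    (hT : TorsionIso W₁ W₂ p)
    (S₀ : Finset (HeightOneSpectrum (𝓞 ℚ))) (hS₀ : ∀ w ∈ S₀, ((p : ℕ) : 𝓞 ℚ) ∉ w.asIdeal)
    (hS₁ : ∀ w : HeightOneSpectrum (𝓞 ℚ), w ∉ S₀ → ((p : ℕ) : 𝓞 ℚ) ∉ w.asIdeal →
      W₁.HasGoodReductionAt w)
    (hS₂ : ∀ w : HeightOneSpectrum (𝓞 ℚ), w ∉ S₀ → ((p : ℕ) : 𝓞 ℚ) ∉ w.asIdeal →
      W₂.HasGoodReductionAt w)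
    {κ : ZpExtension ℚ p} {γ : absoluteGaloisGroup ℚ} (hκ : κ.IsCyclotomic)
    (hγ : κ.IsTopGenerator γ) (hγ' : IsCyclotomicVariable p γ)
    (D₁ : W₁.SelmerDualData κ γ) (D₂ : W₂.SelmerDualData κ γ)
    [Module.Finite (IwasawaAlgebra p) D₁.X] [Module.Finite (IwasawaAlgebra p) D₂.X]
    (hX₁ : D₁.IsTorsion) (hX₂ : D₂.IsTorsion) (hμ₁ : D₁.mu = 0) : D₂.mu = 0 := by
  obtain ⟨v, hv⟩ := exists_natCast_mem_asIdeal (p := p)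
  obtain ⟨L₁, L₂, hL₁, hL₂, hiso⟩ :=
    exists_epwLineData_of_goodOrd_pStar_twist p hp2 V₁ V₂ hCW₁ hCW₂ hV₁ hV₂ hT hv
  exact mu_eq_zero_of_epw W₁ W₂ p S₀ hEPW hp2 hv hL₁ hL₂ hirr hiso hS₀ hS₁ hS₂ hκ hγ hγ' D₁ D₂ hX₁ hX₂
    hμ₁

variable {p} {W₁ W₂ : WeierstrassCurve ℚ} [W₁.IsElliptic] [W₁.IsGloballyMinimal] [W₂.IsElliptic]
  [W₂.IsGloballyMinimal]

/-- **X4♯(G-ord) ∩ `I₀*` congruent pairs: Route G's typed input `CongruentLambdaShift W₁ W₂ p e`,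
`e = Σ_{w∈Σ₀} (δ(E₂,w) − δ(E₁,w))`, from EPW + `TorsionIso W₁ W₂ p` + `E₁[p]` irreducible + `Σ₀`** —
both rows' class binders replace the line data. X4♯(G-ord) stays CONSTRUCTION-SHAPED; nothing booked.
[cite: EmertonPollackWeston2006, Thm. 3.3.3 (2) (arXiv:math/0404484 p. 19), Lemma 5.1.5 (p. 30)]
[cite: GreenbergVatsal2000, Thm. (1.4)] -/
theorem ClassX4Gord.congruentLambdaShift_of_epw_of_torsionIso
    (hEPW : muLambdaAlg_transfer_of_torsionIso_potOrd)
    (hX₁ : ClassX4Gord W₁ p) (he₁ : semistabilityIndex W₁ p = 2)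
    (hX₂ : ClassX4Gord W₂ p) (he₂ : semistabilityIndex W₂ p = 2)
    (hirr : W₁.HasIrreducibleModPGaloisRep p) (hT : TorsionIso W₁ W₂ p)
    (S₀ : Finset (HeightOneSpectrum (𝓞 ℚ))) (hS₀ : ∀ w ∈ S₀, ((p : ℕ) : 𝓞 ℚ) ∉ w.asIdeal)
    (hS₁ : ∀ w : HeightOneSpectrum (𝓞 ℚ), w ∉ S₀ → ((p : ℕ) : 𝓞 ℚ) ∉ w.asIdeal →
      W₁.HasGoodReductionAt w)
    (hS₂ : ∀ w : HeightOneSpectrum (𝓞 ℚ), w ∉ S₀ → ((p : ℕ) : 𝓞 ℚ) ∉ w.asIdeal →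
      W₂.HasGoodReductionAt w) :
    CongruentLambdaShift W₁ W₂ p (∑ w ∈ S₀, ((delta W₂ p w : ℤ) - (delta W₁ p w : ℤ))) := by
  obtain ⟨V₁, _, _, C₁, hV₁, hC₁⟩ := ClassX4Gord.exists_goodOrd_pStar_twist_model W₁ p hX₁ he₁
  obtain ⟨V₂, _, _, C₂, hV₂, hC₂⟩ := ClassX4Gord.exists_goodOrd_pStar_twist_model W₂ p hX₂ he₂
  exact congruentLambdaShift_of_epw_of_goodOrd_pStar_twists p hEPW hX₁.addv.1 V₁ V₂ ⟨C₁, hC₁⟩ ⟨C₂, hC₂⟩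
    hV₁ hV₂ hirr hT S₀ hS₀ hS₁ hS₂

/-- **X4♯(G-ord) ∩ `I₀*` congruent pairs: `μ(X(E₁)) = 0 ⟹ μ(X(E₂)) = 0`** (EPW Thm. 3.3.2) from
`TorsionIso` and the class binders. Nothing booked.
[cite: EmertonPollackWeston2006, Thm. 3.3.2 (arXiv:math/0404484 p. 19)] [cite: GreenbergVatsal2000, Thm. (1.4)] -/
theorem ClassX4Gord.mu_eq_zero_of_epw_of_torsionIso
    (hEPW : muLambdaAlg_transfer_of_torsionIso_potOrd)
    (hX₁ : ClassX4Gord W₁ p) (he₁ : semistabilityIndex W₁ p = 2)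
    (hX₂ : ClassX4Gord W₂ p) (he₂ : semistabilityIndex W₂ p = 2)
    (hirr : W₁.HasIrreducibleModPGaloisRep p) (hT : TorsionIso W₁ W₂ p)
    (S₀ : Finset (HeightOneSpectrum (𝓞 ℚ))) (hS₀ : ∀ w ∈ S₀, ((p : ℕ) : 𝓞 ℚ) ∉ w.asIdeal)
    (hS₁ : ∀ w : HeightOneSpectrum (𝓞 ℚ), w ∉ S₀ → ((p : ℕ) : 𝓞 ℚ) ∉ w.asIdeal →
      W₁.HasGoodReductionAt w)
    (hS₂ : ∀ w : HeightOneSpectrum (𝓞 ℚ), w ∉ S₀ → ((p : ℕ) : 𝓞 ℚ) ∉ w.asIdeal →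
      W₂.HasGoodReductionAt w)
    {κ : ZpExtension ℚ p} {γ : absoluteGaloisGroup ℚ} (hκ : κ.IsCyclotomic)
    (hγ : κ.IsTopGenerator γ) (hγ' : IsCyclotomicVariable p γ)
    (D₁ : W₁.SelmerDualData κ γ) (D₂ : W₂.SelmerDualData κ γ)
    [Module.Finite (IwasawaAlgebra p) D₁.X] [Module.Finite (IwasawaAlgebra p) D₂.X]
    (hX₁t : D₁.IsTorsion) (hX₂t : D₂.IsTorsion) (hμ₁ : D₁.mu = 0) : D₂.mu = 0 := by
  obtain ⟨V₁, _, _, C₁, hV₁, hC₁⟩ := ClassX4Gord.exists_goodOrd_pStar_twist_model W₁ p hX₁ he₁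
  obtain ⟨V₂, _, _, C₂, hV₂, hC₂⟩ := ClassX4Gord.exists_goodOrd_pStar_twist_model W₂ p hX₂ he₂
  exact mu_eq_zero_of_epw_of_goodOrd_pStar_twists p hEPW hX₁.addv.1 V₁ V₂ ⟨C₁, hC₁⟩ ⟨C₂, hC₂⟩ hV₁ hV₂
    hirr hT S₀ hS₀ hS₁ hS₂ hκ hγ hγ' D₁ D₂ hX₁t hX₂t hμ₁

/-- **X3♯(G-ord) ∩ `I₀*` congruent pairs (odd `p`): `CongruentLambdaShift W₁ W₂ p e` from EPW +
`TorsionIso` + `E₁[p]` irreducible + `Σ₀`.** Nothing booked.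
[cite: EmertonPollackWeston2006, Thm. 3.3.3 (2) (arXiv:math/0404484 p. 19), Lemma 5.1.5 (p. 30)]
[cite: GreenbergVatsal2000, Thm. (1.4)] -/
theorem ClassX3Gord.congruentLambdaShift_of_epw_of_torsionIso
    (hEPW : muLambdaAlg_transfer_of_torsionIso_potOrd) (hp2 : p ≠ 2)
    (hX₁ : ClassX3Gord W₁ p) (he₁ : semistabilityIndex W₁ p = 2)
    (hX₂ : ClassX3Gord W₂ p) (he₂ : semistabilityIndex W₂ p = 2)
    (hirr : W₁.HasIrreducibleModPGaloisRep p) (hT : TorsionIso W₁ W₂ p)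
    (S₀ : Finset (HeightOneSpectrum (𝓞 ℚ))) (hS₀ : ∀ w ∈ S₀, ((p : ℕ) : 𝓞 ℚ) ∉ w.asIdeal)
    (hS₁ : ∀ w : HeightOneSpectrum (𝓞 ℚ), w ∉ S₀ → ((p : ℕ) : 𝓞 ℚ) ∉ w.asIdeal →
      W₁.HasGoodReductionAt w)
    (hS₂ : ∀ w : HeightOneSpectrum (𝓞 ℚ), w ∉ S₀ → ((p : ℕ) : 𝓞 ℚ) ∉ w.asIdeal →
      W₂.HasGoodReductionAt w) :
    CongruentLambdaShift W₁ W₂ p (∑ w ∈ S₀, ((delta W₂ p w : ℤ) - (delta W₁ p w : ℤ))) := by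
  obtain ⟨V₁, _, _, C₁, hV₁, hC₁⟩ := ClassX3Gord.exists_goodOrd_pStar_twist_model W₁ p hp2 hX₁ he₁
  obtain ⟨V₂, _, _, C₂, hV₂, hC₂⟩ := ClassX3Gord.exists_goodOrd_pStar_twist_model W₂ p hp2 hX₂ he₂
  exact congruentLambdaShift_of_epw_of_goodOrd_pStar_twists p hEPW hp2 V₁ V₂ ⟨C₁, hC₁⟩ ⟨C₂, hC₂⟩ hV₁ hV₂
    hirr hT S₀ hS₀ hS₁ hS₂

/-! ### ERRATUM (route planner 2 GEN 10, ROUTE-2 II.16.1; lead R5-42): the X3 twin above is VACUOUS -/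

/-- **ERRATUM (r2 II.16.1, 2026-08-21): `ClassX3Gord.congruentLambdaShift_of_epw_of_torsionIso` has
jointly unsatisfiable hypotheses** — `ClassX3Gord W p` unfolds to `(Red ∧ Addv) ∧ TypeGOrd` with
`Red W p := ¬ W.HasIrreducibleModPGaloisRep p`, so its binder `hirr : W₁.HasIrreducibleModPGaloisRep p`
contradicts `hX₁`: the theorem refutes nothing and re-words nothing, but it is TRUE VACUOUSLY and
must NOT be cited as X3 coverage. This lemma records the vacuity in the kernel. The repair of
record is the non-vacuous twin over an `hirr`-free transfer fact (ROUTE-2 ARM α, a Greenberg–Vatsal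
type statement for reducible `E[p]` at an additive `p`, to be typed by the typer lane), not this file;
the X4 statements of this file are unaffected (there `hirr` is redundant with `Surj ⊂ ClassX4`).
[cite: GreenbergVatsal2000, Thm. (1.4) (the irreducibility-free transfer the repair will use; nothing asserted here)] -/
theorem ClassX3Gord.not_hasIrreducibleModPGaloisRep {W : WeierstrassCurve ℚ} [W.IsElliptic]
    [W.IsGloballyMinimal] {p : ℕ} [Fact p.Prime] (hX : ClassX3Gord W p) :
    ¬ W.HasIrreducibleModPGaloisRep p :=
  hX.1.1

/-- The vacuity, stated as the referee's probe (cell rule, lead R5-42 (4)): on an X3♯(G-ord) row no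
image binder `hirr` can hold. [folklore] -/
theorem ClassX3Gord.false_of_hasIrreducibleModPGaloisRep {W : WeierstrassCurve ℚ} [W.IsElliptic]
    [W.IsGloballyMinimal] {p : ℕ} [Fact p.Prime] (hX : ClassX3Gord W p)
    (hirr : W.HasIrreducibleModPGaloisRep p) : False :=
  hX.1.1 hirr

end Summit.BirchSwinnertonDyer.Rank1Residual.Additive

end
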